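import Summits.HodgeConjecture.CorCM.GaloisSectionCount
import HarnessLib

/-!
# Counting sections, II: permutations WITH fixed points — twisted-invariant Boolean functions number at most
# `2^((n + f)/2)`, `f` = the number of fixed points carrying the trivial twist

COR-CM (cell `pub-hodgecm2`), binder seat b04 (gen 32), count-neutral own lane «Galois-CM-type classification»: the counting
core of the SKEW-SET theorem (`CorCM/GaloisSkewSection`: a non-central involution in a Galois group of order `≥ 128` yields a CM
type with trivial left and non-trivial right stabiliser, hence a primitive DEGENERATE type).  KERNEL ONLY, Mathlib only: theorems;
no definition, no named fact, no `sorry`.  Sequel of `CorCM/GaloisSectionCount` (gen 31: the fixed-point-free case).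

* `card_filter_invariant_le_fix` — for a permutation `ψ` of a finite type `α`, the `ψ`-invariant Boolean functions number at most
  `2^((|α| + |Fix ψ|)/2)`: they factor through the cycle quotient, and a cycle class not reduced to a fixed point has `≥ 2` elements.
* `card_filter_twisted_le_fix` — the affine systems `ε(ψ z) = ε(z) ⊻ τ(z)` (`ψ` injective) have at most
  `2^((|α| + |{z : ψ z = z ∧ τ z = false}|)/2)` solutions: none at all if a fixed point carries the twist `τ = true`, and otherwise two
  solutions differ by an invariant function.
* `exists_forall_violated_fix` — union bound: if `Σ_{v ∈ V} 2^((|α| + f_v)/2) < 2^|α|` (`f_v` the number of `τ_v`-trivial fixed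
  points of `ψ_v`), some `ε` violates every system.

## References

* [Kubota1965] T. Kubota, *On the field extension by complex multiplication*, Trans. AMS 118 (1965), §2 (context only).
-/

namespace Summit.HodgeConjecture.CorCM.GaloisModels.SectionCount

open Finset

variable {α : Type*} [Fintype α] [DecidableEq α]

/-- **Invariant Boolean functions under a permutation number at most `2^((|α| + |Fix|)/2)`.** [folklore] -/
theorem card_filter_invariant_le_fix (ψ : Equiv.Perm α) :
    (Finset.univ.filter fun δ : α → Bool => ∀ z, δ (ψ z) = δ z).card ≤
      2 ^ ((Fintype.card α + (Finset.univ.filter fun z : α => ψ z = z).card) / 2) := by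
  classical
  let S : Setoid α := ⟨ψ.SameCycle, ⟨fun x => Equiv.Perm.SameCycle.refl ψ x, fun h => h.symm, fun h₁ h₂ => h₁.trans h₂⟩⟩
  let π : α → Quotient S := Quotient.mk S
  have hinj : ((Finset.univ.filter fun δ : α → Bool => ∀ z, δ (ψ z) = δ z).card) ≤ Fintype.card (Quotient S → Bool) := by
    rw [← Fintype.card_coe]
    refine Fintype.card_le_of_injective
      (fun δ => Quotient.lift (δ.1 : α → Bool) (fun x y (h : ψ.SameCycle x y) =>
        eq_of_sameCycle_of_invariant ψ δ.1 (Finset.mem_filter.1 δ.2).2 h)) ?_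
    intro δ₁ δ₂ h
    apply Subtype.ext
    funext z
    have := congrFun h (π z)
    simpa [π] using this
  -- every fibre of `π` is non-empty, and has `≥ 2` elements unless it is the class of a fixed point
  set Fix := Finset.univ.filter fun z : α => ψ z = z with hFix
  have hfib1 : ∀ q : Quotient S, 1 ≤ (Finset.univ.filter fun z : α => π z = q).card := by
    intro q
    obtain ⟨z, rfl⟩ := Quotient.exists_rep q
    exact Finset.card_pos.2 ⟨z, by simp [π]⟩
  have hfib2 : ∀ q : Quotient S, q ∉ Fix.image π → 2 ≤ (Finset.univ.filter fun z : α => π z = q).card := by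
    intro q hq
    obtain ⟨z, rfl⟩ := Quotient.exists_rep q
    have hz : ψ z ≠ z := fun h => hq (Finset.mem_image.2 ⟨z, by rw [hFix, Finset.mem_filter]; exact ⟨Finset.mem_univ z, h⟩, rfl⟩)
    refine Finset.one_lt_card.2 ⟨z, ?_, ψ z, ?_, hz.symm⟩
    · simp [π]
    · simp only [Finset.mem_filter, Finset.mem_univ, true_and, π]
      exact Quotient.sound (⟨-1, by simp⟩ : ψ.SameCycle (ψ z) z)
  have hcardQ : 2 * Fintype.card (Quotient S) ≤ Fintype.card α + Fix.card := by
    have hsum : Fintype.card α = ∑ q ∈ (Finset.univ : Finset (Quotient S)),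
        (Finset.univ.filter fun z : α => π z = q).card := by
      rw [← Finset.card_univ]; exact Finset.card_eq_sum_card_fiberwise fun z _ => Finset.mem_univ (π z)
    have himg : (Fix.image π).card ≤ Fix.card := Finset.card_image_le
    have hsplit : ∑ q ∈ (Finset.univ : Finset (Quotient S)), (Finset.univ.filter fun z : α => π z = q).card
        ≥ ∑ q ∈ (Finset.univ : Finset (Quotient S)), (if q ∈ Fix.image π then 1 else 2) :=
      Finset.sum_le_sum fun q _ => by
        split_ifs with h
        · exact hfib1 q
        · exact hfib2 q h
    have hite : ∑ q ∈ (Finset.univ : Finset (Quotient S)), (if q ∈ Fix.image π then 1 else 2)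
        = 2 * (Finset.univ : Finset (Quotient S)).card - (Finset.univ.filter fun q : Quotient S => q ∈ Fix.image π).card := by
      rw [Finset.sum_ite, Finset.sum_const, Finset.sum_const, smul_eq_mul, smul_eq_mul, mul_one]
      have := Finset.card_filter_add_card_filter_not (s := (Finset.univ : Finset (Quotient S)))
        (fun q => q ∈ Fix.image π)
      omega
    have hfilt : (Finset.univ.filter fun q : Quotient S => q ∈ Fix.image π).card ≤ Fix.card :=
      (Finset.card_le_card (fun q hq => (Finset.mem_filter.1 hq).2)).trans himg
    have h2 := hsplit
    rw [hite] at h2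
    have hle : (Finset.univ.filter fun q : Quotient S => q ∈ Fix.image π).card ≤ (Finset.univ : Finset (Quotient S)).card :=
      Finset.card_le_card (Finset.filter_subset _ _)
    have hQ : Fintype.card (Quotient S) = (Finset.univ : Finset (Quotient S)).card := Finset.card_univ.symm
    rw [hQ, hsum]
    omega
  calc ((Finset.univ.filter fun δ : α → Bool => ∀ z, δ (ψ z) = δ z).card)
      ≤ Fintype.card (Quotient S → Bool) := hinj
    _ = 2 ^ Fintype.card (Quotient S) := by rw [Fintype.card_fun, Fintype.card_bool]
    _ ≤ 2 ^ ((Fintype.card α + Fix.card) / 2) := Nat.pow_le_pow_right (by norm_num) (by omega)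

/-- **The twisted systems `ε(ψ z) = ε(z) ⊻ τ(z)` (`ψ` injective) have at most `2^((|α| + f)/2)` solutions, `f` = the number of
fixed points of `ψ` with `τ = false`**: a fixed point with `τ = true` kills every solution; otherwise two solutions differ by a
`ψ`-invariant function. [folklore] -/
theorem card_filter_twisted_le_fix (ψ : α → α) (hinj : Function.Injective ψ) (τ : α → Bool) :
    (Finset.univ.filter fun ε : α → Bool => ∀ z, ε (ψ z) = xor (ε z) (τ z)).card ≤
      2 ^ ((Fintype.card α + (Finset.univ.filter fun z : α => ψ z = z ∧ τ z = false).card) / 2) := by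
  classical
  set Sol := Finset.univ.filter fun ε : α → Bool => ∀ z, ε (ψ z) = xor (ε z) (τ z) with hSol
  by_cases hne : Sol = ∅
  · rw [hne, Finset.card_empty]; exact Nat.zero_le _
  obtain ⟨ε₀, hε₀⟩ := Finset.nonempty_iff_ne_empty.2 hne
  have hε₀' : ∀ z, ε₀ (ψ z) = xor (ε₀ z) (τ z) := (Finset.mem_filter.1 hε₀).2
  -- a fixed point carries `τ = false`
  have hfixτ : ∀ z, ψ z = z → τ z = false := by
    intro z hz
    have h := hε₀' z
    rw [hz] at h
    cases h1 : ε₀ z <;> cases h2 : τ z <;> simp_all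
  have hFixeq : (Finset.univ.filter fun z : α => ψ z = z ∧ τ z = false) = Finset.univ.filter fun z : α => ψ z = z := by
    ext z; simp only [Finset.mem_filter, Finset.mem_univ, true_and]
    exact ⟨fun h => h.1, fun h => ⟨h, hfixτ z h⟩⟩
  let Ψ : Equiv.Perm α := Equiv.ofBijective ψ (Finite.injective_iff_bijective.1 hinj)
  have hΨ : ∀ z, Ψ z = ψ z := fun z => rfl
  have hmap : ∀ ε ∈ Sol, (fun z => xor (ε z) (ε₀ z)) ∈
      (Finset.univ.filter fun δ : α → Bool => ∀ z, δ (Ψ z) = δ z) := by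
    intro ε hε
    have hε' : ∀ z, ε (ψ z) = xor (ε z) (τ z) := (Finset.mem_filter.1 hε).2
    simp only [Finset.mem_filter, Finset.mem_univ, true_and, hΨ]
    intro z
    rw [hε' z, hε₀' z]
    cases ε z <;> cases ε₀ z <;> cases τ z <;> rfl
  have hFixΨ : (Finset.univ.filter fun z : α => Ψ z = z) = Finset.univ.filter fun z : α => ψ z = z := by
    ext z; simp only [Finset.mem_filter, hΨ]
  calc Sol.card ≤ (Finset.univ.filter fun δ : α → Bool => ∀ z, δ (Ψ z) = δ z).card := by
        refine Finset.card_le_card_of_injOn (fun ε => fun z => xor (ε z) (ε₀ z)) hmap ?_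
        intro ε₁ _ ε₂ _ h
        funext z
        have := congrFun h z
        simp only at this
        cases h1 : ε₁ z <;> cases h2 : ε₂ z <;> cases h0 : ε₀ z <;> simp_all
    _ ≤ 2 ^ ((Fintype.card α + (Finset.univ.filter fun z : α => Ψ z = z).card) / 2) := card_filter_invariant_le_fix Ψ
    _ = _ := by rw [hFixΨ, hFixeq]

/-- **UNION BOUND with fixed points.**  If `Σ_{v ∈ V} 2^((|α| + f_v)/2) < 2^|α|`, `f_v` the number of fixed points of `ψ_v` with
`τ_v = false`, then some `ε : α → Bool` violates, for every `v ∈ V`, at least one constraint `ε(ψ_v z) = ε(z) ⊻ τ_v(z)`. [folklore] -/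
theorem exists_forall_violated_fix {ι : Type*} (V : Finset ι) (ψ : ι → α → α) (hinj : ∀ v ∈ V, Function.Injective (ψ v))
    (τ : ι → α → Bool)
    (hbig : ∑ v ∈ V, 2 ^ ((Fintype.card α + (Finset.univ.filter fun z : α => ψ v z = z ∧ τ v z = false).card) / 2)
      < 2 ^ Fintype.card α) :
    ∃ ε : α → Bool, ∀ v ∈ V, ∃ z, ε (ψ v z) ≠ xor (ε z) (τ v z) := by
  classical
  by_contra H
  have hcover : (Finset.univ : Finset (α → Bool)) ⊆
      V.biUnion fun v => Finset.univ.filter fun ε : α → Bool => ∀ z, ε (ψ v z) = xor (ε z) (τ v z) := by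
    intro ε _
    rw [Finset.mem_biUnion]
    by_contra h
    refine H ⟨ε, fun v hv => ?_⟩
    by_contra h'
    refine h ⟨v, hv, Finset.mem_filter.2 ⟨Finset.mem_univ _, fun z => ?_⟩⟩
    by_contra h''
    exact h' ⟨z, h''⟩
  have h1 := Finset.card_le_card hcover
  have h2 : (V.biUnion fun v => Finset.univ.filter fun ε : α → Bool => ∀ z, ε (ψ v z) = xor (ε z) (τ v z)).card ≤
      ∑ v ∈ V, 2 ^ ((Fintype.card α + (Finset.univ.filter fun z : α => ψ v z = z ∧ τ v z = false).card) / 2) :=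
    (Finset.card_biUnion_le).trans (Finset.sum_le_sum fun v hv => card_filter_twisted_le_fix (ψ v) (hinj v hv) (τ v))
  rw [Finset.card_univ, Fintype.card_fun, Fintype.card_bool] at h1
  omega

end Summit.HodgeConjecture.CorCM.GaloisModels.SectionCount
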